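import Summits.BirchSwinnertonDyer.Rank1Residual.Additive.CycLeadingTermDvdConverse
import HarnessLib

/-!
# The LOWER half on the (M) locus, rank `0`, EVERY odd `p`: the Tamagawa binder `p ∤ c_p(E)`
# DISCHARGED (Kodaira `Iₙ*`: `c_p ∈ {1, 2, 4}`) — binder-free iff and binder-free `BSD(E,p)` from
# both `T = 0` directions (cell `b2b-bsdres`, team n1011, seat n1011-p18, sub-target T-N10b; sequel
# of `Additive/CycLeadingTermDvdConverse.lean`)

HONEST FRAMING (cell `b2b-bsdres`, run/shared/lean/b2b/bsd-rank1-residual/, verbatim in every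
file): the goal of the cell is to DELETE the COMBINATION-SHAPED residual classes of the
Birch–Swinnerton-Dyer formula for ALL analytic-rank `≤ 1` elliptic curves over `ℚ` — "full BSD
formula for every rank `≤ 1` curve in class `C`" assembled STRICTLY from published theorems — so
that the rank-`≤ 1` remainder becomes exactly the CONSTRUCTION-SHAPED classes, which are TYPED
(missing-input `Prop`s), NOT attempted. This is not "finishing BSD". Team n1011 (RESIDUAL-MAP §I
N10/N11), sub-target T-N10b: research route; no claim beyond the stated classes; N10 stays
CONSTRUCTION / NEEDS; labels unchanged; nothing booked. THEOREMS ONLY (no definition, no named fact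
minted); every published input is an explicit named-fact hypothesis of the tree; no `_holds`.

## What this file proves

The (M)-locus theorems of `Additive/CycLeadingTermDvdConverse.lean` §1–§3 carry the binder
`p ∤ c_p(E)`. On the (M) locus it is a THEOREM at every odd `p`, `3` included: `E ≅ V^{(p*)}` with `V`
multiplicative at `p`, Kodaira type `Iₙ*`, `c_p ∈ {1, 2, 4}` (Tate's algorithm Steps 6–7; seat
additive-p1's `AdditivePotMult.PotMult.not_dvd_tamagawaNumberAt`, file `AdditivePotMult/TamagawaAtP.lean`,
on additive-p4's `tamagawaNumberAt_twist_pm_p_mem`). Hence, binder-free: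

* `PotMult.missingLowerBoundAt_iff_cycLeadingTermDvdAt_rankZero` — on (M) ∧ `r_an = 0`, EVERY odd `p`:
  **`Typed.MissingLowerBoundAt W p ↔ CycLeadingTermDvdAt W p`** (granted Delbourgo 1998 Prop. 4 in
  both transcriptions, GZK, modularity); class forms `ClassX4M.…`, `ClassX3M.…`.
* `ClassX4M.bsdp_rankZero_of_bothDirections` / `ClassX3M.bsdp_rankZero_of_bothDirections` — on
  X4(M) / X3♯(M) ∧ `r_an = 0`, EVERY odd `p`: **`BSD(E,p)` ⟸ `CycLeadingTermAt W p ∧ CycLeadingTermDvdAt W p`**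
  (Delbourgo's Main Conjecture at `T = 0`, both directions) + Delbourgo Prop. 4 (both
  transcriptions) + GZK + modularity — NO image, Tamagawa, Manin, Wuthrich/Kato-reading or
  certificate binder at all.
* `ClassX4M.x4MissingInputAt_iff_cycLeadingTermDvdAt_rankZero_of_surj`,
  `ClassX3M.x3MissingInputAt_iff_cycLeadingTermDvdAt_rankZero` — what remains of X4♯ on X4(M) ∧ surj
  resp. of X3♯ on X3♯(M) in rank `0` is EXACTLY the typed `T = 0` divisibility (binder-free forms
  of the `…Converse` §4 iffs; published-fact upper halves of seat additive-p1).

X4(M), X3♯(M) stay CONSTRUCTION-SHAPED (the typed input is printed nowhere); nothing booked.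

References: D. Delbourgo, Compositio Math. 113 (1998) 123–154, §2.2 Lemma (ii) (p. 139), Prop. 4
(p. 144), Main Conjecture (p. 151) [Delbourgo1998]; J. H. Silverman, *ATAEC* IV.9.4 Steps 6–7
[SilvermanATAEC1994]; R. L. Miller, LMS J. Comput. Math. 14 (2011) Def. 1.1 [Miller2011LMS];
C. Wuthrich, Doc. Math. 19 (2014) Thm. 16, Lemma 20, Cor. 19 [Wuthrich2014].
-/

noncomputable section

open scoped Classical NumberField

open WeierstrassCurve NumberField Literature.NumberTheory.EllipticCurves
  Literature.NumberTheory.EllipticCurves.ModularForms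
  Literature.NumberTheory.EllipticCurves.Rank1Residual
  Literature.NumberTheory.EllipticCurves.Rank1Residual.Typed
  IsDedekindDomain Rat.HeightOneSpectrum

namespace Summit.BirchSwinnertonDyer.Rank1Residual.AdditivePotMult

open Additive

variable {W : WeierstrassCurve ℚ} [W.IsElliptic] [W.IsGloballyMinimal] {p : ℕ} [hp : Fact p.Prime]

/-! ### §1 Binder-free iff on the (M) locus -/

/-- **(M) ∧ `r_an = 0`, EVERY odd `p` (`3` included): `MissingLowerBoundAt W p ↔ CycLeadingTermDvdAt W p`**
— the Tamagawa binder of `missingLowerBoundAt_iff_cycLeadingTermDvdAt_of_potMult` discharged by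
`PotMult.not_dvd_tamagawaNumberAt` (`c_p ∈ {1,2,4}` on a potentially multiplicative row).
[cite: Delbourgo1998, Prop. 4 (p. 144), §2.2 Lemma (ii) (p. 139), Main Conjecture (p. 151)]
[cite: SilvermanATAEC1994, IV.9.4 Steps 6–7 (PDF pp. 345–346)] -/
theorem PotMult.missingLowerBoundAt_iff_cycLeadingTermDvdAt_rankZero
    (hDel : Delbourgo1998.prop4_rankZero_pow_dvd_constantCoeff)
    (hDelX : Delbourgo1998.prop4_rankZero_constantCoeff_eq_unit_mul_of_potMult)
    (hGZK : rank_eq_analyticRank_of_analyticRank_le_one) (hmod : hasEntireLFunction_rat)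
    (hpm : PotMult W p) (hp2 : p ≠ 2) (hr : W.analyticRank = 0) :
    MissingLowerBoundAt W p ↔ CycLeadingTermDvdAt W p :=
  missingLowerBoundAt_iff_cycLeadingTermDvdAt_of_potMult W p hDel hDelX hGZK hmod hp2 hpm.1 hpm.2 hr
    (hpm.not_dvd_tamagawaNumberAt hp2)

/-- **X4(M) ∧ `r_an = 0`: `MissingLowerBoundAt W p ↔ CycLeadingTermDvdAt W p`** (binder-free).
[cite: Delbourgo1998, Prop. 4 (p. 144), §2.2 Lemma (ii) (p. 139), Main Conjecture (p. 151)] -/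
theorem ClassX4M.missingLowerBoundAt_iff_cycLeadingTermDvdAt_rankZero
    (hDel : Delbourgo1998.prop4_rankZero_pow_dvd_constantCoeff)
    (hDelX : Delbourgo1998.prop4_rankZero_constantCoeff_eq_unit_mul_of_potMult)
    (hGZK : rank_eq_analyticRank_of_analyticRank_le_one) (hmod : hasEntireLFunction_rat)
    (hX : ClassX4M W p) (hr : W.analyticRank = 0) :
    MissingLowerBoundAt W p ↔ CycLeadingTermDvdAt W p :=
  PotMult.missingLowerBoundAt_iff_cycLeadingTermDvdAt_rankZero hDel hDelX hGZK hmod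
    (ClassX4M.potMult W p hX) hX.1.1 hr

/-- **X3♯(M) ∧ `r_an = 0`: `MissingLowerBoundAt W p ↔ CycLeadingTermDvdAt W p`** (binder-free).
[cite: Delbourgo1998, Prop. 4 (p. 144), §2.2 Lemma (ii) (p. 139), Main Conjecture (p. 151)] -/
theorem ClassX3M.missingLowerBoundAt_iff_cycLeadingTermDvdAt_rankZero
    (hDel : Delbourgo1998.prop4_rankZero_pow_dvd_constantCoeff)
    (hDelX : Delbourgo1998.prop4_rankZero_constantCoeff_eq_unit_mul_of_potMult)
    (hGZK : rank_eq_analyticRank_of_analyticRank_le_one) (hmod : hasEntireLFunction_rat)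
    (hX : ClassX3M W p) (hr : W.analyticRank = 0) :
    MissingLowerBoundAt W p ↔ CycLeadingTermDvdAt W p :=
  PotMult.missingLowerBoundAt_iff_cycLeadingTermDvdAt_rankZero hDel hDelX hGZK hmod
    (ClassX3M.potMult W p hX) (ClassX3M.p_ne_two W p hX) hr

/-! ### §2 Binder-free `BSD(E,p)` from both `T = 0` directions on the (M) locus -/

/-- **X4(M) ∧ `r_an = 0`, EVERY odd `p`: `BSD(E,p)` ⟸ Delbourgo's Main Conjecture at `T = 0` in BOTH
directions** (`CycLeadingTermAt W p ∧ CycLeadingTermDvdAt W p`) + Prop. 4 (both transcriptions) +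
GZK + modularity — no image, Tamagawa, Manin or certificate binder. X4(M) stays CONSTRUCTION-SHAPED.
[cite: Delbourgo1998, Prop. 4 (p. 144), §2.2 Lemma (ii) (p. 139), Main Conjecture (p. 151)]
[cite: SilvermanATAEC1994, IV.9.4 Steps 6–7 (PDF pp. 345–346)] -/
theorem ClassX4M.bsdp_rankZero_of_bothDirections
    (hDel : Delbourgo1998.prop4_rankZero_pow_dvd_constantCoeff)
    (hDelX : Delbourgo1998.prop4_rankZero_constantCoeff_eq_unit_mul_of_potMult)
    (hGZK : rank_eq_analyticRank_of_analyticRank_le_one) (hmod : hasEntireLFunction_rat)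
    (hX : ClassX4M W p) (hr : W.analyticRank = 0)
    (hLT : CycLeadingTermAt W p) (hDvd : CycLeadingTermDvdAt W p) : BSDp W p :=
  ClassX4M.bsdp_rankZero_of_cycLeadingTerm_of_cycLeadingTermDvd hDel hDelX hGZK hmod hX hr
    (ClassX4M.not_dvd_tamagawaNumberAt hX) hLT hDvd

/-- **X3♯(M) ∧ `r_an = 0`, EVERY odd `p`: `BSD(E,p)` ⟸ Delbourgo's Main Conjecture at `T = 0` in
BOTH directions** (binder-free; no image hypothesis anywhere). X3♯(M) stays CONSTRUCTION-SHAPED.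
[cite: Delbourgo1998, Prop. 4 (p. 144), §2.2 Lemma (ii) (p. 139), Main Conjecture (p. 151)]
[cite: SilvermanATAEC1994, IV.9.4 Steps 6–7 (PDF pp. 345–346)] -/
theorem ClassX3M.bsdp_rankZero_of_bothDirections
    (hDel : Delbourgo1998.prop4_rankZero_pow_dvd_constantCoeff)
    (hDelX : Delbourgo1998.prop4_rankZero_constantCoeff_eq_unit_mul_of_potMult)
    (hGZK : rank_eq_analyticRank_of_analyticRank_le_one) (hmod : hasEntireLFunction_rat)
    (hX : ClassX3M W p) (hr : W.analyticRank = 0)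
    (hLT : CycLeadingTermAt W p) (hDvd : CycLeadingTermDvdAt W p) : BSDp W p :=
  ClassX3M.bsdp_rankZero_of_cycLeadingTerm_of_cycLeadingTermDvd hDel hDelX hGZK hmod hX hr
    (ClassX3M.not_dvd_tamagawaNumberAt hX) hLT hDvd

/-! ### §3 Binder-free "what remains is EXACTLY the typed `T = 0` divisibility" -/

/-- **X4(M) ∧ surj(p) ∧ `r_an = 0`, EVERY odd `p`: `Typed.X4.MissingInputAt W p ↔ CycLeadingTermDvdAt W p`**
(binder-free; upper half from seat additive-p1's published-fact chain: Delbourgo Prop. 4, Kato on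
the `ω^{(p−1)/2}`-component `hKato`, Wuthrich Lemma 20 `hL20`, `hmodD`, GZK, modularity).
[cite: Delbourgo1998, Prop. 4 (p. 144), §2.2 Lemma (ii) (p. 139), Main Conjecture (p. 151)]
[cite: Wuthrich2014, Lemma 20 (p. 399), Cor. 19 (p. 398)] -/
theorem ClassX4M.x4MissingInputAt_iff_cycLeadingTermDvdAt_rankZero_of_surj
    (hDel : Delbourgo1998.prop4_rankZero_pow_dvd_constantCoeff)
    (hDelX : Delbourgo1998.prop4_rankZero_constantCoeff_eq_unit_mul_of_potMult)
    (hGZK : rank_eq_analyticRank_of_analyticRank_le_one) (hmod : hasEntireLFunction_rat)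
    (hmodD : nonempty_modularParametrizationData)
    (hL20 : Wuthrich2014.lemma20_surjective_threeAdic_of_semistable)
    (hKato : Wuthrich2014.kato_halfEigenCharIdeal_dvd_cyclotomicPrime_of_surjective)
    (hX : ClassX4M W p) (hr : W.analyticRank = 0) (hsurj : Surj W p) :
    X4.MissingInputAt W p ↔ CycLeadingTermDvdAt W p :=
  ClassX4M.missingInputAt_iff_cycLeadingTermDvdAt_rankZero_of_surj hDel hDelX hGZK hmod hmodD hL20
    hKato hX hr hsurj (ClassX4M.not_dvd_tamagawaNumberAt hX)

/-- **X3♯(M) ∧ `r_an = 0`, EVERY odd `p`: `Typed.X3.MissingInputAt W p ↔ CycLeadingTermDvdAt W p`**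
(binder-free; upper half from Delbourgo Prop. 4 + Wuthrich 2014 Thm. 16 on the
`ω^{(p−1)/2}`-component `hW16`, `hmodD`, GZK, modularity).
[cite: Delbourgo1998, Prop. 4 (p. 144), §2.2 Lemma (ii) (p. 139), Main Conjecture (p. 151)]
[cite: Wuthrich2014, Thm. 16 (p. 397)] -/
theorem ClassX3M.x3MissingInputAt_iff_cycLeadingTermDvdAt_rankZero
    (hDel : Delbourgo1998.prop4_rankZero_pow_dvd_constantCoeff)
    (hDelX : Delbourgo1998.prop4_rankZero_constantCoeff_eq_unit_mul_of_potMult)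
    (hGZK : rank_eq_analyticRank_of_analyticRank_le_one) (hmod : hasEntireLFunction_rat)
    (hmodD : nonempty_modularParametrizationData)
    (hW16 : Wuthrich2014.thm16_halfEigenCharIdeal_dvd_cyclotomicPrime)
    (hX : ClassX3M W p) (hr : W.analyticRank = 0) :
    X3.MissingInputAt W p ↔ CycLeadingTermDvdAt W p :=
  ClassX3M.missingInputAt_iff_cycLeadingTermDvdAt_rankZero hDel hDelX hGZK hmod hmodD hW16 hX hr
    (ClassX3M.not_dvd_tamagawaNumberAt hX)

end Summit.BirchSwinnertonDyer.Rank1Residual.AdditivePotMult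

end
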